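import Summits.BirchSwinnertonDyer.Rank1Residual.Supersingular.SharpFlatRankZeroReal
import Literature.NumberTheory.EllipticCurves.AnomalousOfRationalTorsionProofs
import HarnessLib

/-!
# Rational torsion on class X8 (`p = 3` good supersingular, `a_3 = ±3`): `a_3 = 3` ⟹ `E(ℚ)_tors = 0`;
# `a_3 = −3` ⟹ `#E(ℚ)_tors` is a power of `7` — and the general lemma behind it: every prime dividing
# `#E(ℚ)_tors` divides `#Ẽ(𝔽_p) = p + 1 − a_p` at EVERY good prime `p ≥ 3`
# (cell `b2b-bsdres`, supersingular family, prover B = unit `b2b-bsdres-additive-p3`, gen 12)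

HONEST FRAMING (run/shared/lean/b2b/bsd-rank1-residual/, verbatim in every file): the goal of the
cell is to DELETE the COMBINATION-SHAPED residual classes of the Birch–Swinnerton-Dyer formula for
ALL analytic-rank `≤ 1` elliptic curves over `ℚ` — "full BSD formula for every rank `≤ 1` curve in
class `C`" assembled STRICTLY from published theorems — so that the rank-`≤ 1` remainder becomes
exactly the CONSTRUCTION-SHAPED classes, which are TYPED (missing-input `Prop`s), NOT attempted.
This is not "finishing BSD". X8 stays CONSTRUCTION-SHAPED; nothing is booked; no definition, no named
fact (theorems only, elementary: Silverman AEC VII.3.1(b) in the tree's form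
`addOrderOf_dvd_reductionPointCount` + Cauchy's theorem in `E(ℚ)_tors`).

## Statements (`W/ℚ` globally minimal elliptic, `N_p = W.reductionPointCount p = #Ẽ(𝔽_p)`, `a_p = p + 1 − N_p`)

* `prime_dvd_reductionPointCount_of_dvd_torsionOrder` — **a prime `ℓ ∣ #E(ℚ)_tors` divides `N_p` at
  every good prime `p ≥ 3`** (the tree had the case `ℓ = p` only, `dvd_reductionPointCount_of_dvd_torsionOrder`):
  Cauchy gives `T ∈ E(ℚ)` of order `ℓ`, and `N_p · T = O` (AEC VII.3.1(b): `E(ℚ)_tors ↪ Ẽ(𝔽_p)`).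
* `torsionOrder_eq_one_of_reductionPointCount_eq_one` — `N_p = 1` at a good `p ≥ 3` ⟹ `#E(ℚ)_tors = 1`;
  `torsionOrder_eq_prime_pow_of_reductionPointCount_eq_prime` — `N_p = q` prime ⟹ `#E(ℚ)_tors = q^k`.
* By Hasse, `N_p = 1` forces `p ≤ 4`: for `p = 3` it is exactly `a_3 = 3`, i.e. class X8 with the `+`
  sign — `Ẽ(𝔽₃)(𝔽₃) = {O}` (`reductionPointCount_three_eq_one_iff`), the case `α = 1 + ζ₆` of the
  Mazur–Tate theory (`MazurTateConstantTerms.lean`: the forced zeros `θ_n(0) = 0`, `n ≡ 2 (mod 6)`).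
  **`ClassX8.torsionOrder_eq_one`: X8 ∧ `a_3 = 3` ⟹ `E(ℚ)_tors = 0`.** `a_3 = −3` ⟹ `N_3 = 7` ⟹ every
  prime dividing `#E(ℚ)_tors` is `7`, `#E(ℚ)_tors = 7^k` (`ClassX8.torsionOrder_eq_seven_pow`; Mazur's
  list, not used here, then leaves `{1, 7}`). Either sign: `2 ∤ #E(ℚ)_tors`, `3 ∤ #E(ℚ)_tors`
  (`ClassX8.not_two_dvd_torsionOrder`, `ClassX8.not_three_dvd_torsionOrder` — the latter without the
  irreducibility of `E[3]`), so the torsion term of the BSD quotient is a `2`- and `3`-adic unit on X8 and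
  ABSENT on X8⁺. Supersingular `a_p = 0` (X6/X7, odd `p`): every prime dividing `#E(ℚ)_tors` divides
  `p + 1` (`prime_dvd_succ_of_dvd_torsionOrder_of_frobeniusTrace_eq_zero`); at `p = 3`, `a_3 = 0`:
  `#E(ℚ)_tors` is a power of `2`.
Census (Cremona `allbsd`, all curves with `3 ∤ N`, `N < 5·10⁵`, gen-12 script `g12/a3_asymmetry_census.py`):
`a_3 = 3`: 39 171 curves, `#E(ℚ)_tors = 1` on all; `a_3 = −3`: 40 518 curves, `#E(ℚ)_tors = 1` on 40 497
and `= 7` on 21 — as the theorems say. Nothing is booked; per-class bookkeeping only.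

References: Silverman, *AEC* 2nd ed., VII.3.1(b), VIII.7.1, V.1.1 (Hasse) [SilvermanAEC2009];
Mazur, Invent. Math. 18 (1972) §1 [Mazur1972].
-/

set_option autoImplicit false

noncomputable section

open scoped Classical

open WeierstrassCurve Literature.NumberTheory.EllipticCurves
  Literature.NumberTheory.EllipticCurves.Rank1Residual

namespace Summit.BirchSwinnertonDyer.Rank1Residual.Supersingular

section General

variable (W : WeierstrassCurve ℚ) [W.IsElliptic] [W.IsGloballyMinimal] (p : ℕ) [Fact p.Prime]

/-- **A prime dividing `#E(ℚ)_tors` divides `#Ẽ(𝔽_p)` at every good prime `p ≥ 3`.** Cauchy's theorem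
in the finite group `E(ℚ)_tors` gives a rational point `T` of order `ℓ`; `N_p · T = O` (Silverman AEC
VII.3.1(b), tree `addOrderOf_dvd_reductionPointCount`), so `ℓ = ord T ∣ N_p`. [cite: SilvermanAEC2009, VII.3.1(b) and VIII.7.1] -/
theorem prime_dvd_reductionPointCount_of_dvd_torsionOrder (hp : 3 ≤ p)
    (hgood : W.HasGoodReductionAtPrime p) {ℓ : ℕ} (hℓ : ℓ.Prime) (h : ℓ ∣ W.torsionOrder) :
    ℓ ∣ W.reductionPointCount p := by
  haveI : Fact ℓ.Prime := ⟨hℓ⟩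
  obtain ⟨T, hT⟩ := exists_addOrderOf_eq_of_dvd_torsionOrder W ℓ h
  have hfin : IsOfFinAddOrder T := addOrderOf_pos_iff.mp (by rw [hT]; exact hℓ.pos)
  exact hT ▸ addOrderOf_dvd_reductionPointCount W p hp
    (not_dvd_minimalDiscriminantInt_of_hasGoodReductionAtPrime' W p hgood) hfin

omit [W.IsElliptic] [Fact p.Prime] in
/-- `N_p = p + 1 − a_p` (the definition of the trace of Frobenius, rearranged). [folklore] -/
theorem natCast_reductionPointCount_eq :
    (W.reductionPointCount p : ℤ) = (p : ℤ) + 1 - W.frobeniusTrace p := by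
  unfold WeierstrassCurve.frobeniusTrace
  ring

/-- **`#Ẽ(𝔽_p) = 1` at a good prime `p ≥ 3` ⟹ `E(ℚ)_tors = 0`** (`#E(ℚ)_tors = 1`): a prime divisor of
`#E(ℚ)_tors` would divide `1`. [cite: SilvermanAEC2009, VII.3.1(b)] -/
theorem torsionOrder_eq_one_of_reductionPointCount_eq_one (hp : 3 ≤ p)
    (hgood : W.HasGoodReductionAtPrime p) (h1 : W.reductionPointCount p = 1) :
    W.torsionOrder = 1 := by
  by_contra hne
  obtain ⟨ℓ, hℓ, hdvd⟩ := Nat.exists_prime_and_dvd hne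
  have h := prime_dvd_reductionPointCount_of_dvd_torsionOrder W p hp hgood hℓ hdvd
  rw [h1, Nat.dvd_one] at h
  exact hℓ.one_lt.ne' h

/-- **`#Ẽ(𝔽_p) = q` prime at a good prime `p ≥ 3` ⟹ every prime dividing `#E(ℚ)_tors` is `q`.**
[cite: SilvermanAEC2009, VII.3.1(b)] -/
theorem eq_of_prime_dvd_torsionOrder_of_reductionPointCount_eq_prime (hp : 3 ≤ p)
    (hgood : W.HasGoodReductionAtPrime p) {q : ℕ} (hq : q.Prime) (hN : W.reductionPointCount p = q)
    {ℓ : ℕ} (hℓ : ℓ.Prime) (h : ℓ ∣ W.torsionOrder) : ℓ = q := by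
  have hd := prime_dvd_reductionPointCount_of_dvd_torsionOrder W p hp hgood hℓ h
  rw [hN] at hd
  exact (Nat.prime_dvd_prime_iff_eq hℓ hq).mp hd

/-- **`#Ẽ(𝔽_p) = q` prime at a good prime `p ≥ 3` ⟹ `#E(ℚ)_tors` is a power of `q`.**
[cite: SilvermanAEC2009, VII.3.1(b) and VIII.7.1] -/
theorem torsionOrder_eq_prime_pow_of_reductionPointCount_eq_prime (hp : 3 ≤ p)
    (hgood : W.HasGoodReductionAtPrime p) {q : ℕ} (hq : q.Prime) (hN : W.reductionPointCount p = q) :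
    ∃ k : ℕ, W.torsionOrder = q ^ k :=
  ⟨_, Nat.eq_prime_pow_of_unique_prime_dvd (torsionOrder_pos_holds (W := W)).ne'
      (fun hd hdvd ↦ eq_of_prime_dvd_torsionOrder_of_reductionPointCount_eq_prime W p hp hgood hq hN
        hd hdvd)⟩

/-- **Supersingular with `a_p = 0` (odd good `p`): every prime dividing `#E(ℚ)_tors` divides `p + 1`**
(`N_p = p + 1`). For `p = 3`, `a_3 = 0` (X6/X7 at `3`): `#E(ℚ)_tors` is a power of `2`.
[cite: SilvermanAEC2009, VII.3.1(b)] -/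
theorem prime_dvd_succ_of_dvd_torsionOrder_of_frobeniusTrace_eq_zero (hp : 3 ≤ p)
    (hgood : W.HasGoodReductionAtPrime p) (hap : W.frobeniusTrace p = 0)
    {ℓ : ℕ} (hℓ : ℓ.Prime) (h : ℓ ∣ W.torsionOrder) : ℓ ∣ p + 1 := by
  have hd := prime_dvd_reductionPointCount_of_dvd_torsionOrder W p hp hgood hℓ h
  have hN : W.reductionPointCount p = p + 1 := by
    have := natCast_reductionPointCount_eq W p
    rw [hap, sub_zero] at this
    exact_mod_cast this
  rwa [hN] at hd

end General

/-! ### Class X8: `a_3 = 3` (no rational torsion at all) and `a_3 = −3` (a power of `7`) -/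

section X8

variable (W : WeierstrassCurve ℚ) [W.IsElliptic] [W.IsGloballyMinimal] (p : ℕ) [Fact p.Prime]

omit [W.IsElliptic] [Fact p.Prime] in
/-- `#Ẽ(𝔽₃) = 1 ⟺ a_3 = 3` (`a_3 = 4 − N_3`). By Hasse this "no points but `O`" can only happen at
`p ≤ 4`; at `p = 3` it is the `+` half of class X8. [folklore] -/
theorem reductionPointCount_three_eq_one_iff :
    W.reductionPointCount 3 = 1 ↔ W.frobeniusTrace 3 = 3 := by
  have h := natCast_reductionPointCount_eq W 3
  push_cast at h
  constructor
  · intro h1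
    rw [h1] at h
    push_cast at h
    linarith
  · intro h3
    rw [h3] at h
    exact_mod_cast (by linarith : (W.reductionPointCount 3 : ℤ) = 1)

omit [W.IsElliptic] [Fact p.Prime] in
/-- `#Ẽ(𝔽₃) = 7 ⟺ a_3 = −3`. [folklore] -/
theorem reductionPointCount_three_eq_seven_iff :
    W.reductionPointCount 3 = 7 ↔ W.frobeniusTrace 3 = -3 := by
  have h := natCast_reductionPointCount_eq W 3
  push_cast at h
  constructor
  · intro h7
    rw [h7] at h
    push_cast at h
    linarith
  · intro h3
    rw [h3] at h
    exact_mod_cast (by linarith : (W.reductionPointCount 3 : ℤ) = 7)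

/-- **X8 ∧ `a_3 = 3` ⟹ `E(ℚ)_tors = 0`** (`#E(ℚ)_tors = 1`): `Ẽ(𝔽₃)` has the single point `O`, and
`E(ℚ)_tors ↪ Ẽ(𝔽₃)` at the good prime `3` (AEC VII.3.1(b)). So on the `+` half of X8 the BSD quotient
has NO torsion term. Census: all 39 171 Cremona curves with `3 ∤ N`, `N < 5·10⁵`, `a_3 = 3` have
trivial torsion. [cite: SilvermanAEC2009, VII.3.1(b)] -/
theorem ClassX8.torsionOrder_eq_one (hX : ClassX8 W p) (h3 : W.frobeniusTrace 3 = 3) :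
    W.torsionOrder = 1 :=
  haveI : Fact (Nat.Prime 3) := ⟨Nat.prime_three⟩
  torsionOrder_eq_one_of_reductionPointCount_eq_one W 3 le_rfl hX.2.1.1
    ((reductionPointCount_three_eq_one_iff W).mpr h3)

/-- **X8 ∧ `a_3 = −3` ⟹ every prime dividing `#E(ℚ)_tors` is `7`** (`#Ẽ(𝔽₃) = 7`).
[cite: SilvermanAEC2009, VII.3.1(b)] -/
theorem ClassX8.eq_seven_of_prime_dvd_torsionOrder (hX : ClassX8 W p) (h3 : W.frobeniusTrace 3 = -3)
    {ℓ : ℕ} (hℓ : ℓ.Prime) (h : ℓ ∣ W.torsionOrder) : ℓ = 7 :=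
  haveI : Fact (Nat.Prime 3) := ⟨Nat.prime_three⟩
  eq_of_prime_dvd_torsionOrder_of_reductionPointCount_eq_prime W 3 le_rfl hX.2.1.1 (by norm_num)
    ((reductionPointCount_three_eq_seven_iff W).mpr h3) hℓ h

/-- **X8 ∧ `a_3 = −3` ⟹ `#E(ℚ)_tors = 7^k`** (census: `7^0` on 40 497 and `7^1` on 21 of the 40 518
Cremona curves with `3 ∤ N`, `N < 5·10⁵`, `a_3 = −3`; Mazur's theorem, not used, excludes `k ≥ 2`).
[cite: SilvermanAEC2009, VII.3.1(b) and VIII.7.1] -/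
theorem ClassX8.torsionOrder_eq_seven_pow (hX : ClassX8 W p) (h3 : W.frobeniusTrace 3 = -3) :
    ∃ k : ℕ, W.torsionOrder = 7 ^ k :=
  haveI : Fact (Nat.Prime 3) := ⟨Nat.prime_three⟩
  torsionOrder_eq_prime_pow_of_reductionPointCount_eq_prime W 3 le_rfl hX.2.1.1 (by norm_num)
    ((reductionPointCount_three_eq_seven_iff W).mpr h3)

/-- **X8 (either sign) ⟹ every prime dividing `#E(ℚ)_tors` is `7`** (trivially for `a_3 = 3`, where
there is no torsion). [cite: SilvermanAEC2009, VII.3.1(b)] -/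
theorem ClassX8.eq_seven_of_prime_dvd_torsionOrder' (hX : ClassX8 W p)
    {ℓ : ℕ} (hℓ : ℓ.Prime) (h : ℓ ∣ W.torsionOrder) : ℓ = 7 := by
  rcases ClassX8.frobeniusTrace_eq_three_or W p hX with h3 | h3
  · exfalso
    rw [ClassX8.torsionOrder_eq_one W p hX h3, Nat.dvd_one] at h
    exact hℓ.one_lt.ne' h
  · exact ClassX8.eq_seven_of_prime_dvd_torsionOrder W p hX h3 hℓ h

/-- **X8 ⟹ `3 ∤ #E(ℚ)_tors`** — here from the point count at `3` alone (the tree also has it from the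
irreducibility of `E[3]`, `ClassX8.irr'`). [cite: SilvermanAEC2009, VII.3.1(b)] -/
theorem ClassX8.not_three_dvd_torsionOrder (hX : ClassX8 W p) : ¬ 3 ∣ W.torsionOrder :=
  fun h ↦ by have := ClassX8.eq_seven_of_prime_dvd_torsionOrder' W p hX Nat.prime_three h; omega

/-- **X8 ⟹ `2 ∤ #E(ℚ)_tors`**: no rational `2`-torsion on class X8 (so the "no-torsion" and the
"torsion" print shapes of the BSD quotient differ by a `2`-adic and `3`-adic unit, a power of `7`).
[cite: SilvermanAEC2009, VII.3.1(b)] -/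
theorem ClassX8.not_two_dvd_torsionOrder (hX : ClassX8 W p) : ¬ 2 ∣ W.torsionOrder :=
  fun h ↦ by have := ClassX8.eq_seven_of_prime_dvd_torsionOrder' W p hX Nat.prime_two h; omega

/-- **X8 ⟹ `padicValNat 3 #E(ℚ)_tors = 0`** (the form the cell's print shapes use). [cite: SilvermanAEC2009, VII.3.1(b)] -/
theorem ClassX8.padicValNat_three_torsionOrder (hX : ClassX8 W p) :
    padicValNat 3 W.torsionOrder = 0 :=
  padicValNat.eq_zero_of_not_dvd (ClassX8.not_three_dvd_torsionOrder W p hX)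

end X8

end Summit.BirchSwinnertonDyer.Rank1Residual.Supersingular

end
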